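import Summits.Ventures.HodgeRepro2.T5SU11SphericalConvolution
import Summits.Ventures.HodgeRepro2.T5SU11XiTransform
import Summits.Ventures.HodgeRepro2.T5SU11JacobiCrossCheck

/-!
# The convolution of two coefficient moduli: `(m_k ∗ m_l)^(λ) = m̂_k(λ) m̂_l(λ)`

The convolution theorem of `T5SU11SphericalConvolution` applied to the coefficient moduli
`m_k = (1 − |g·0|²)^{k/2}` (continuous, bi-`K`-invariant, in `L¹(ν)` for `k > 2`) and the closed form of
`T5SU11JacobiTransform` give the spherical transform of `m_k ∗ m_l` in closed form for `0 ≤ λ ≤ 2`: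
**`∫_G (m_k ∗ m_l)(x) φ_λ(x) dν = m̂_k(λ) m̂_l(λ)`** with `m̂_k(λ) = 2^{k−2} C_k Γ((k−λ)/2) Γ((k+λ)/2 − 1)/Γ(k−1)`
(`integral_convolution_orbit_rpow_mul_sph`); at `λ = 0` the `L¹`-norm `(2π)²/((k − 2)(l − 2))`
(`integral_convolution_orbit_rpow`) and at `λ = 1` the `Ξ`-transform `C_k² C_l²`
(`integral_convolution_orbit_rpow_mul_sph_one`). Nothing is claimed about (N).

Blind lane: Mathlib + the HodgeRepro2 prefix only; no sorry; axioms ⊆ {propext, Classical.choice,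
Quot.sound}.
-/

namespace Summit.Ventures.HodgeRepro2.T5SU11ConvolutionModuli

open MeasureTheory MeasureTheory.Measure Metric Set Filter Topology
open T5SU11Unimodular T5SU11Fibration T5SU11Cartan T5HaarCircle T5BergmanCoefficient
  T5SU11FibrationHaar T5SU11SphericalFunction T5SU11SphericalSymmetry T5SU11JacobiIwasawa
  T5SU11JacobiTransform T5SU11JacobiCrossCheck T5SU11SphericalConvolution T5SU11XiTransform
open scoped Real

/-- `m_k` is bi-`K`-invariant (restated for the convolution theorem). -/
lemma orbit_rpow_biRot (k : ℝ) (u v : Circle) (g : SU11) :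
    (1 - ‖orbit (rot u * g * rot v)‖ ^ 2) ^ (k / 2) = (1 - ‖orbit g‖ ^ 2) ^ (k / 2) :=
  orbit_rpow_rot_mul_rot k u v g

section measure

variable [MeasurableSpace Circle] [BorelSpace Circle]

/-- **The transform of `m_k ∗ m_l`**: for `k, l > 2` and `0 ≤ λ ≤ 2`,
`∫_G (∫_G m_k(y) m_l(y⁻¹ x) dν(y)) φ_λ(x) dν(x) = m̂_k(λ) m̂_l(λ)`. -/
theorem integral_convolution_orbit_rpow_mul_sph {k l lam : ℝ} (hk : 2 < k) (hl : 2 < l)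
    (h0 : 0 ≤ lam) (h2 : lam ≤ 2) :
    ∫ x, (∫ y, (1 - ‖orbit y‖ ^ 2) ^ (k / 2) * (1 - ‖orbit (y⁻¹ * x)‖ ^ 2) ^ (l / 2) ∂(nu haarCircle))
        * sph lam x ∂(nu haarCircle)
      = (2 ^ (k - 2) * (√π * Real.Gamma ((k - 1) / 2) / Real.Gamma (k / 2))
          * (Real.Gamma ((k - lam) / 2) * Real.Gamma ((k + lam) / 2 - 1) / Real.Gamma (k - 1)))
        * (2 ^ (l - 2) * (√π * Real.Gamma ((l - 1) / 2) / Real.Gamma (l / 2))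
          * (Real.Gamma ((l - lam) / 2) * Real.Gamma ((l + lam) / 2 - 1) / Real.Gamma (l - 1))) := by
  rw [integral_convolution_mul_sph h0 h2 (continuous_orbit_rpow k) (continuous_orbit_rpow l)
    (integrable_orbit_rpow hk) (integrable_orbit_rpow hl) (orbit_rpow_biRot l),
    integral_orbit_rpow_mul_sph (by linarith) (by linarith) (by linarith),
    integral_orbit_rpow_mul_sph (by linarith) (by linarith) (by linarith)]

/-- **The `L¹`-norm of `m_k ∗ m_l`** (`λ = 0`, `φ_0 ≡ 1`): `∫_G (m_k ∗ m_l) dν = (2π)²/((k − 2)(l − 2))`. -/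
theorem integral_convolution_orbit_rpow {k l : ℝ} (hk : 2 < k) (hl : 2 < l) :
    ∫ x, (∫ y, (1 - ‖orbit y‖ ^ 2) ^ (k / 2) * (1 - ‖orbit (y⁻¹ * x)‖ ^ 2) ^ (l / 2) ∂(nu haarCircle))
        ∂(nu haarCircle)
      = (2 * π / (k - 2)) * (2 * π / (l - 2)) := by
  have h := integral_convolution_mul_sph (lam := 0) le_rfl (by norm_num) (continuous_orbit_rpow k)
    (continuous_orbit_rpow l) (integrable_orbit_rpow hk) (integrable_orbit_rpow hl) (orbit_rpow_biRot l)
  simp only [sph_zero, mul_one] at h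
  rw [h, integral_orbit_rpow_nu hk, integral_orbit_rpow_nu hl]

/-- **The `Ξ`-transform of `m_k ∗ m_l`**: `∫_G (m_k ∗ m_l) Ξ dν = C_k² C_l²`. -/
theorem integral_convolution_orbit_rpow_mul_sph_one {k l : ℝ} (hk : 2 < k) (hl : 2 < l) :
    ∫ x, (∫ y, (1 - ‖orbit y‖ ^ 2) ^ (k / 2) * (1 - ‖orbit (y⁻¹ * x)‖ ^ 2) ^ (l / 2) ∂(nu haarCircle))
        * sph 1 x ∂(nu haarCircle)
      = (√π * Real.Gamma ((k - 1) / 2) / Real.Gamma (k / 2)) ^ 2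
        * (√π * Real.Gamma ((l - 1) / 2) / Real.Gamma (l / 2)) ^ 2 := by
  rw [integral_convolution_mul_sph zero_le_one one_le_two (continuous_orbit_rpow k)
    (continuous_orbit_rpow l) (integrable_orbit_rpow hk) (integrable_orbit_rpow hl) (orbit_rpow_biRot l),
    integral_orbit_rpow_mul_sph_one_eq_sq (by linarith), integral_orbit_rpow_mul_sph_one_eq_sq (by linarith)]

end measure

end Summit.Ventures.HodgeRepro2.T5SU11ConvolutionModuli
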